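import Summits.QuantumFields.YangMills.Theorems.UnitScaleTiltProp7QTwFlatConstantFormsT3
import Summits.QuantumFields.YangMills.Theorems.UnitScaleTiltProp7CmapTwSReadSet
import HarnessLib

/-!
# Route `UnitScaleTilt`, crux «MinimiserStabilityRegPr» (stmt-QuantumFields-19200), route-R E′ (A′)-comb, COMB-FLAT COERCIVITY ⟸ (I3′) filling certificate (★★OWNER RULINGS g29-№17∕№18;
# ✓`Prop7SliceRowOfFilling` v1.1), F-c-2 item (i) «CHAIN FORMS» (w4-19200 g8 05:40:53Z «px21: (i) first refusal»; px21 g6 «MINE» 05:41Z): **THE `ℤ³` LETTERS OF THE FLAT FRAME RESPONSE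
# READ AS TORUS CHAINS** — the level-`j` linear average `LʲQ_j(1)X♯` of the pulled-back field IS the corner-box mean of straight torus segment sums of length `Lʲ` («tube_box»), and the
# contour sums of the pullback ARE torus walk sums: the dictionary through which ✓p695582∕✓p697180's `r₁`, `QTw 1`, `QTwS 1 − QTw 1` become explicit signed means of `segSum`∕`walkSum` chains

Cell `ym3-torus` (HUMAN RULING D-0037, YM ladder rung R3 — YM₃ on T³ is a rung, NOT d = 4, NOT infinite volume, NOT a mass gap, NOT Clay; YM gap NOT proved), width seat
`ym3-torus-px21` (gen 6).  THEOREMS ONLY (0 `def`, 0 `sorry`); `--supports stmt-QuantumFields-19200 --as helper`; count-neutral.  Nothing here is a claim about the stub, the crux or any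
summit statement.

THE PRINT.  [Balaban1984PropagatorsI] (1.8) p. 19 («A(Γ) = Σ_{b⊂Γ} A_b»), (1.11)∕(1.18) pp. 19–20 (`(Q_kA)_b = Σ_{x∈B^k(b₋)} η^{d+1} A([x, x(b)])` — «a composition of k operators Q is the
operator Q_k»); [Balaban1985Averaging] (9) p. 18 (parallel transport along words), (125)–(127) pp. 36–37, p. 39; the torus reading of the `ℤᵈ` pullback is lit ✓`B10Eq27TorusAxialLog.hol_pull`
(group-valued); this file is its LINEAR (Lie-algebra) twin plus the one-stroke form ✓`B7Prop4Flat.linQIter_eq_linQ_pow` read on the torus.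

WHAT IS PROVED (ns `…Theorems.Prop7DefectChainForms`; `P : Params`, `x₀ y : Site P j`, `X : PBond P j → 𝔸`, `X♯_y z κ := X ⟨transl y z, κ⟩`).
* §1 ★ `asum_pull_eq_walkSum_walk` — `asum X♯_y z w = walkSum X (walk (transl y z) w)` for every word `w` (the linear ✓`hol_pull`).
* §2 `transl_add_natSmul_e_eq_runSite`, ★ `sum_pull_seg_eq_segSum` — `Σ_{i<N} X♯_y (p + i•e_κ) κ = segSum X (transl y p) κ N`; ★★ `linQ_pull_eq_boxMean_segSum`,
  ★★★ `linQIter_pull_eq_boxMean_segSum` — **`LʲQ_j(1)X♯ (z, κ) = Σ_{r ∈ [0,Lʲ)ᵈ} (Lʲ)^{−d} • segSum X (transl y (Lʲ•z + r)) κ Lʲ`**: the level-`j` letter of ✓p695582 is the CORNER-BOX MEAN OF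
  STRAIGHT TORUS TUBES of length `Lʲ` issued from the box `x̂ + Lʲz + [0,Lʲ)ᵈ` («tube_box» of RULING №18).
* §3 `Fhat_eq_sum_treeWord`, ★ `Fhat_linQIter_pull_eq`, `asum_cons_true∕false` — `F̂(q)[LʲQ_jX♯]` as the signed mean over the tree contours of the §2 tube means (every summand of
  `r₁ X y = Σ_j F̂(L^{k−j}ŷ)[LʲQ_jX♯]`, ✓`fderiv_frameTw_one_apply`).
* §4 (i-T) `segSum_translate` (`segSum (X ∘ translate a) x = segSum X (x + a)`), ★★ `smul_bondAvgIter_eq_cellMean_segSum` (`Lᵏ•Q_kX(b) = ((Lᵏ)ᵈ)⁻¹ Σ_{x∈Bᵏ(b₋)} segSum X x b.dir Lᵏ`, lit ✓`bondAvgIter_eq_blockSum`).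
* §5 (i-Λ) `bondAvgIter_eq_smul_cellTubeField`, ★★ `walkSum_bondAvgIter_eq`, ★★★ `combLevel_chainForm` (the level-`j` piece `Lʲ•λ̄_{Q_jY}(y)` = mean over `Idx` of the stair walk sums from
  `emb y` of the CELL-SMEARED tube field — SPEC-Fc2 v2 A1 on the stair side), ★ `segSum_eq_walkSum_walk_replicate` (every tube is a level-0 `walkSum` along a straight word).
* §6 (member) `transl_basePt_add`, ★★★ `frameResponse_level_eq_centred` (the level-`j` summand of `r₁ X y` with issue point `x̂_y = ctr(B(ŷ))` and the cornered boxes `T_{j+1}` DISPLAYED),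
  ★★ `csmul_bondAvgIter_eq_blockMean_segSum` (the `ℂ`-letter of ✓`QTwS_one_apply`).
HONEST SCOPE.  Dictionary identities (unfoldings + inductions on words); the filling∕Stokes∕counts of F-c-2 (ii)–(iv) are w4-19200 g8's ∕ px6 g6's; nothing of (I3′)∕COMB-FLAT∕the crux.

References: T. Bałaban, CMP **95** (1984) 17–40 [Balaban1984PropagatorsI] ((1.8)–(1.18) pp.19–20); CMP **98** (1985) 17–51 [Balaban1985Averaging] ((9) p.18, (125)–(127) pp.36–37, p.39).
-/

set_option autoImplicit false

noncomputable section

open scoped Matrix.Norms.L2Operator BigOperators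

namespace Summit.QuantumFields.YangMills.Theorems.Prop7DefectChainForms

open Literature.MathematicalPhysics.QuantumFieldTheory.Balaban1983to89
open B7Prop1Explicit renaming Site → LSite
open B7Prop1Explicit (asum stepA boxVec treeWord seg e)
open B7Prop3Flat (Fhat linQ)
open B7Prop4Flat (linQIter linQIter_eq_linQ_pow linQ_eq_sum)
open B10Eq27TorusAxialLog (transl transl_apply transl_add transl_add_e transl_sub_e)
open T4Continuum BlockAveraging LatticeFieldCalculus
open BlockAveragingEMLLinearised (walkSum walkSum_cons combMean combMean_def)
open B5Eq118OneStroke (iterBlock bondAvgIter_eq_blockSum)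
open Summit.QuantumFields.YangMills.Theorems.Prop8Chart (walkSum_const_smul)
open Literature.MathematicalPhysics.QuantumFieldTheory.Balaban1983to89.T3ContinuumYM3Torus
open T3LevelShift (siteShift)
open T3PrintedRegularOrbits (sites_eq)
open B15DeterminingSets (embIter)
open Summit.QuantumFields.YangMills.Theorems.Prop7SPrint (basePt)
open Summit.QuantumFields.YangMills.Theorems.Prop7SymAvgTw (coordT3)
open Summit.QuantumFields.YangMills.Theorems.Prop7AxialReprPrint (embIter_eq_transl)
open Summit.QuantumFields.YangMills.Theorems.Prop7CmapTwSReadSet (height_le)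

variable {P : Params} {j : ℕ} {𝔸 : Type*} [NormedRing 𝔸]

/-! ## §1 Contour sums of the pullback are torus walk sums -/

/-- ★ **THE LINEAR DICTIONARY** (twin of lit ✓`hol_pull`): the signed contour sum of the pulled-back field `X♯_y(z, κ) = X⟨y + z, κ⟩` along a word `w` from `z ∈ ℤᵈ` IS the signed walk sum
of `X` along the same word from `y + z` on the torus. [cite: Balaban1984PropagatorsI, (1.8) p.19; Balaban1985Averaging, (9) p.18] -/
theorem asum_pull_eq_walkSum_walk (X : PBond P j → 𝔸) (y : Site P j) :
    ∀ (z : LSite P.d) (w : List (B7Prop1Explicit.Letter P.d)),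
      asum (fun (z : LSite P.d) (κ : Fin P.d) => X ⟨transl y z, κ⟩) z w = walkSum X (walk (transl y z) w)
  | z, [] => by simp [walk, walkSum]
  | z, (μ, true) :: w => by
    rw [B7Prop1Explicit.asum_cons, B7Prop1Explicit.stepA_true, B7Prop1Explicit.Letter.vec_true, asum_pull_eq_walkSum_walk X y (z + e μ) w, transl_add_e]
    simp only [walk, walkSum_cons, if_true]
  | z, (μ, false) :: w => by
    rw [B7Prop1Explicit.asum_cons, B7Prop1Explicit.stepA_false, B7Prop1Explicit.Letter.vec_false, ← sub_eq_add_neg, asum_pull_eq_walkSum_walk X y (z - e μ) w, transl_sub_e]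
    simp only [walk, walkSum_cons]
    simp

/-- Re-basing a contour sum on `ℤᵈ`: `asum C (q + z) w = asum (C(q + ·)) z w`. [cite: Balaban1985Averaging, p.24] -/
theorem asum_add_base (C : LSite P.d → Fin P.d → 𝔸) (q : LSite P.d) :
    ∀ (w : List (B7Prop1Explicit.Letter P.d)) (z : LSite P.d), asum C (q + z) w = asum (fun (z : LSite P.d) (κ : Fin P.d) => C (q + z) κ) z w
  | [], z => by simp
  | l :: w, z => by
    rw [B7Prop1Explicit.asum_cons, B7Prop1Explicit.asum_cons, add_assoc, asum_add_base C q w (z + l.vec)]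
    congr 1
    obtain ⟨μ, b⟩ := l
    cases b
    · rw [B7Prop1Explicit.stepA_false, B7Prop1Explicit.stepA_false, add_sub_assoc]
    · rw [B7Prop1Explicit.stepA_true, B7Prop1Explicit.stepA_true]

/-- A contour sum read from `q` is the contour sum of the re-based field read from `0`. [cite: Balaban1985Averaging, p.24] -/
theorem asum_rebase_zero (C : LSite P.d → Fin P.d → 𝔸) (q : LSite P.d) (w : List (B7Prop1Explicit.Letter P.d)) :
    asum C q w = asum (fun (z : LSite P.d) (κ : Fin P.d) => C (q + z) κ) 0 w := by
  simpa using asum_add_base C q w 0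

/-! ## §2 The level-`j` linear average of the pullback = corner-box mean of straight torus tubes -/

/-- `y + (p + i•e_κ) = ` the `i`-th site of the straight contour from `y + p` in direction `κ`. [cite: Balaban1984PropagatorsI, (1.7) p.18] -/
theorem transl_add_natSmul_e_eq_runSite (y : Site P j) (p : LSite P.d) (κ : Fin P.d) :
    ∀ i : ℕ, transl y (p + ((i : ℕ) : ℤ) • e κ) = runSite (transl y p) κ i
  | 0 => by simp
  | i + 1 => by
    rw [runSite_succ, ← transl_add_natSmul_e_eq_runSite y p κ i, ← transl_add_e]
    congr 1
    push_cast
    rw [add_smul, one_smul, add_assoc]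

/-- ★ The straight-segment sum of the pullback is the torus `segSum`: `Σ_{i<N} X♯_y(p + i e_κ, κ) = segSum X (y + p) κ N`. [cite: Balaban1984PropagatorsI, (1.8) p.19] -/
theorem sum_pull_seg_eq_segSum (X : PBond P j → 𝔸) (y : Site P j) (p : LSite P.d) (κ : Fin P.d) (N : ℕ) :
    ∑ i : Fin N, X ⟨transl y (p + ((i : ℕ) : ℤ) • e κ), κ⟩ = segSum X (transl y p) κ N := by
  unfold segSum
  rw [← Fin.sum_univ_eq_sum_range]
  exact Finset.sum_congr rfl fun i _ => by rw [transl_add_natSmul_e_eq_runSite]; rfl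

section Averages

variable [NormedAlgebra ℂ 𝔸]

/-- ★★ **THE ONE-BLOCK LINEAR AVERAGE OF THE PULLBACK = BOX MEAN OF TORUS TUBES**: `linQ N X♯_y p κ = Σ_{r∈[0,N)ᵈ} N^{−d} • segSum X (y + p + r) κ N`.
[cite: Balaban1985Averaging, (125) p.36; Balaban1984PropagatorsI, (1.11) p.19] -/
theorem linQ_pull_eq_boxMean_segSum (N : ℕ) (X : PBond P j → 𝔸) (y : Site P j) (p : LSite P.d) (κ : Fin P.d) :
    linQ N (fun (z : LSite P.d) (κ : Fin P.d) => X ⟨transl y z, κ⟩) p κ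
      = ∑ r : Fin P.d → Fin N, (((N : ℝ) ^ P.d)⁻¹) • segSum X (transl y (p + boxVec N r)) κ N := by
  rw [linQ_eq_sum]
  exact Finset.sum_congr rfl fun r _ => by rw [sum_pull_seg_eq_segSum]

/-- ★★★ **THE LEVEL-`j` LETTER OF ✓p695582 ON THE TORUS — «tube_box»**: `LʲQ_j(1)X♯_y (z, κ) = Σ_{r ∈ [0,Lʲ)ᵈ} (Lʲ)^{−d} • segSum X (y + (Lʲ•z + r)) κ Lʲ` — the mean, over the box of side
`Lʲ` CORNERED at `y + Lʲz`, of the sums of `X` along the straight torus tubes of length `Lʲ` in direction `κ` (✓`linQIter_eq_linQ_pow` «a composition of k operators Q is Q_k» ∘ §2).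
[cite: Balaban1984PropagatorsI, (1.18) p.20; Balaban1985Averaging, p.39, (127) p.37] -/
theorem linQIter_pull_eq_boxMean_segSum (L : ℕ) (X : PBond P j → 𝔸) (y : Site P j) (i : ℕ) (z : LSite P.d) (κ : Fin P.d) :
    linQIter L (fun (z : LSite P.d) (κ : Fin P.d) => X ⟨transl y z, κ⟩) i z κ
      = ∑ r : Fin P.d → Fin (L ^ i), ((((L ^ i : ℕ) : ℝ) ^ P.d)⁻¹) • segSum X (transl y ((((L ^ i : ℕ) : ℤ)) • z + boxVec (L ^ i) r)) κ (L ^ i) := by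
  rw [linQIter_eq_linQ_pow, linQ_pull_eq_boxMean_segSum]

/-! ## §3 The frame exponent's linearisation as a signed mean of steps -/

/-- ★★ **`F̂(q)[C] = Σ_{r∈[0,L)ᵈ} L^{−d} • asum C q (treeWord r)`, the contour sum UNROLLED**: along any word, `asum C x (l :: w) = (±C at the step's bond) + asum C (x + l.vec) w` — so every
summand of `r₁ X y = Σ_{j<k} F̂(L^{k−j}ŷ)[LʲQ_jX♯]` (✓`fderiv_frameTw_one_apply`) is a signed mean of the level-`j` tube letters of §2 at the sites of the tree contours `Γ_{q, q+r}`.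
[cite: Balaban1985Averaging, (112) p.34, p.24] -/
theorem Fhat_eq_sum_treeWord (L : ℕ) (C : LSite P.d → Fin P.d → 𝔸) (q : LSite P.d) :
    Fhat L C q = ∑ r : Fin P.d → Fin L, (((L : ℝ) ^ P.d)⁻¹) • asum C q (treeWord (boxVec L r)) := rfl

end Averages

/-- The signed step value: `+C(x, μ)` on a forward letter, `−C(x − e_μ, μ)` on a backward one (`B7Prop1Explicit.stepA`). [cite: Balaban1985Averaging, p.24] -/
theorem asum_cons_true (C : LSite P.d → Fin P.d → 𝔸) (x : LSite P.d) (μ : Fin P.d) (w : List (B7Prop1Explicit.Letter P.d)) :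
    asum C x ((μ, true) :: w) = C x μ + asum C (x + e μ) w := by
  rw [B7Prop1Explicit.asum_cons, B7Prop1Explicit.stepA_true, B7Prop1Explicit.Letter.vec_true]

/-- The backward step. [cite: Balaban1985Averaging, p.24] -/
theorem asum_cons_false (C : LSite P.d → Fin P.d → 𝔸) (x : LSite P.d) (μ : Fin P.d) (w : List (B7Prop1Explicit.Letter P.d)) :
    asum C x ((μ, false) :: w) = -C (x - e μ) μ + asum C (x - e μ) w := by
  rw [B7Prop1Explicit.asum_cons, B7Prop1Explicit.stepA_false, B7Prop1Explicit.Letter.vec_false, ← sub_eq_add_neg]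

/-- ★ (i-r) **THE LEVEL-`j` SUMMAND OF `r₁` AS A SIGNED MEAN OF TORUS TUBES**: `F̂(q)[LʲQ_j(1)X♯_y] = Σ_{r∈[0,L)ᵈ} L^{−d} • asum (z κ ↦ Σ_{u∈[0,Lʲ)ᵈ} (Lʲ)^{−d} • segSum X (y + (Lʲz + u)) κ Lʲ) q (treeWord r)`
— the comb words are the tree contours `Γ_{q,q+r}` of the level-`j` unit lattice read from `q` (for `r₁ X y`: `q = L^{k−j}•ŷ`, i.e. issued from `ctr(ŷ)`), each of whose steps carries the corner-box
mean of straight torus tubes of length `Lʲ` (§2; smearing = uniform on the box `y + Lʲz + [0,Lʲ)ᵈ` — SPEC-Fc2 A1 on the comb side). [cite: Balaban1985Averaging, (112) p.34, (127) p.37, (160) p.42] -/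
theorem Fhat_linQIter_pull_eq [NormedAlgebra ℂ 𝔸] (L : ℕ) (X : PBond P j → 𝔸) (y : Site P j) (i : ℕ) (q : LSite P.d) :
    Fhat L (linQIter L (fun (z : LSite P.d) (κ : Fin P.d) => X ⟨transl y z, κ⟩) i) q
      = ∑ r : Fin P.d → Fin L, (((L : ℝ) ^ P.d)⁻¹) •
          asum (fun (z : LSite P.d) (κ : Fin P.d) =>
              ∑ u : Fin P.d → Fin (L ^ i), ((((L ^ i : ℕ) : ℝ) ^ P.d)⁻¹) • segSum X (transl y ((((L ^ i : ℕ) : ℤ)) • z + boxVec (L ^ i) u)) κ (L ^ i))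
            q (treeWord (boxVec L r)) := by
  have hfun : linQIter L (fun (z : LSite P.d) (κ : Fin P.d) => X ⟨transl y z, κ⟩) i
      = fun (z : LSite P.d) (κ : Fin P.d) => ∑ u : Fin P.d → Fin (L ^ i), ((((L ^ i : ℕ) : ℝ) ^ P.d)⁻¹) • segSum X (transl y ((((L ^ i : ℕ) : ℤ)) • z + boxVec (L ^ i) u)) κ (L ^ i) :=
    funext fun z => funext fun κ => linQIter_pull_eq_boxMean_segSum L X y i z κ
  rw [hfun]
  rfl

/-! ## §4 (i-T) The translated field's tubes and `ℓ•Q_k` as a block mean of tubes -/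

section Torus

variable {V : Type*} [AddCommGroup V] [Module ℝ V]

/-- Straight contours commute with lattice translations: `runSite (x + a) μ t = runSite x μ t + a`. [cite: Balaban1984PropagatorsI, (1.7) p.18] -/
theorem runSite_add_translate (x a : Site P j) (μ : Fin P.d) : ∀ t : ℕ, runSite (x + a) μ t = runSite x μ t + a
  | 0 => by simp
  | t + 1 => by rw [runSite_succ, runSite_succ, runSite_add_translate x a μ t, Site.shift_add]

omit [Module ℝ V] in
/-- ★ (i-T) **THE TUBES OF THE TRANSLATED FIELD**: `segSum (b ↦ X (b.translate a)) x μ N = segSum X (x + a) μ N` (for the SPEC's `X′ := X ∘ translate (−v)`: the tube of `X′` from `x` is the tube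
of `X` from `x − v`). [cite: Balaban1984PropagatorsI, (1.8) p.19] -/
theorem segSum_translate (X : PBond P j → V) (a x : Site P j) (μ : Fin P.d) (N : ℕ) :
    segSum (fun b : PBond P j => X (b.translate a)) x μ N = segSum X (x + a) μ N := by
  unfold segSum
  refine Finset.sum_congr rfl fun t _ => ?_
  simp only [runBond, PBond.translate, runSite_add_translate]

/-- ★★ (i-T) **`Lᵏ•Q_kX` AS THE BLOCK MEAN OF STRAIGHT TUBES** (lit ✓`B5Eq118OneStroke.bondAvgIter_eq_blockSum`, (1.18) one-stroke, rescaled): for `k ≤ m + K`,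
`(Lᵏ : ℝ) • bondAvgIter k X b = ((Lᵏ)ᵈ)⁻¹ • Σ_{x ∈ Bᵏ(b₋)} segSum X x b.dir Lᵏ` — the uniform measure on the level-`k` CELL `Bᵏ(b₋)` (SPEC-Fc2 A1 on the straight side).
[cite: Balaban1984PropagatorsI, (1.18) p.20] -/
theorem smul_bondAvgIter_eq_cellMean_segSum {k : ℕ} (hk : k ≤ P.m + P.K) (X : PBond P 0 → V) (b : PBond P k) :
    ((P.L : ℝ) ^ k) • bondAvgIter k X b = ((((P.L : ℝ) ^ k) ^ P.d)⁻¹) • ∑ x ∈ iterBlock k b.src, segSum X x b.dir (P.L ^ k) := by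
  rw [bondAvgIter_eq_blockSum k hk X b, smul_smul]
  congr 1
  have hL : (P.L : ℝ) ≠ 0 := Nat.cast_ne_zero.mpr P.L_pos.ne'
  rw [← pow_mul, ← pow_mul, show (P.d + 1) * k = k + k * P.d by ring, pow_add, mul_inv, ← mul_assoc, mul_inv_cancel₀ (pow_ne_zero _ hL), one_mul]

/-! ## §5 (i-Λ) The comb functional's level pieces as smeared stair walk sums -/

/-- (i-Λ) **THE LEVEL-`j` STRAIGHT AVERAGE AS A CELL-SMEARED TUBE FIELD**: `bondAvgIter j Y = ((L^{d+1})^j)⁻¹ • (b ↦ Σ_{x ∈ Bʲ(b₋)} segSum Y x b.dir Lʲ)` (✓`bondAvgIter_eq_blockSum` as a field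
identity). [cite: Balaban1984PropagatorsI, (1.18) p.20] -/
theorem bondAvgIter_eq_smul_cellTubeField {i : ℕ} (hi : i ≤ P.m + P.K) (Y : PBond P 0 → V) :
    bondAvgIter i Y = fun b : PBond P i => ((((P.L : ℝ) ^ (P.d + 1)) ^ i)⁻¹) • ∑ x ∈ iterBlock i b.src, segSum Y x b.dir (P.L ^ i) :=
  funext fun b => bondAvgIter_eq_blockSum i hi Y b

/-- ★★ (i-Λ) **A LEVEL-`j` WALK SUM OF `Q_jY` IS A SMEARED WALK SUM OF TUBES**: along any level-`j` step list `γ`,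
`walkSum (bondAvgIter j Y) γ = ((L^{d+1})^j)⁻¹ • walkSum (b ↦ Σ_{x∈Bʲ(b₋)} segSum Y x b.dir Lʲ) γ` — every step `±⟨z, κ⟩` of `γ` carries `±` the sum, over the uniform cell `Bʲ(z)` (measure `ν_j`), of
the straight torus tubes of length `Lʲ` in direction `κ`. [cite: Balaban1984PropagatorsI, (1.8) p.19, (1.18) p.20] -/
theorem walkSum_bondAvgIter_eq {i : ℕ} (hi : i ≤ P.m + P.K) (Y : PBond P 0 → V) (γ : List (LStep P i)) :
    walkSum (bondAvgIter i Y) γ = ((((P.L : ℝ) ^ (P.d + 1)) ^ i)⁻¹) • walkSum (fun b : PBond P i => ∑ x ∈ iterBlock i b.src, segSum Y x b.dir (P.L ^ i)) γ := by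
  rw [bondAvgIter_eq_smul_cellTubeField hi, walkSum_const_smul]

/-- ★★★ (i-Λ) **THE LEVEL-`j` PIECE OF THE COMB FUNCTIONAL IN CHAIN FORM**: `Lʲ • λ̄_{Q_jY}(y) = |I|⁻¹ • Σ_{i∈I} Lʲ • ((L^{d+1})^j)⁻¹ • walkSum (cell-tube field) (walk (emb y) (stairWord …))`
— word = the staircase `stairWord` of (0.3), start = the centre `emb y`, smearing = the uniform level-`j` cells (ν_j); with the recursion `Λ_{j+1}(Y)(y) = Lʲ•λ̄_{Q_jY}(y) + Λ_j(Y)(emb y)`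
(✓`ChartHInv`∕`exists_combFamily`) this is the level decomposition of `Λ_k` the SPEC's `C_Λ` asks for. [cite: Balaban1985Averaging, (62) p.28; Balaban1984PropagatorsI, (1.18) p.20; Balaban1987RG1, (0.3)–(0.4) p.253] -/
theorem combLevel_chainForm {n : Type*} {i : ℕ} (hi : i ≤ P.m + P.K) (Y : PBond P 0 → Matrix n n ℂ) (y : Site P (i + 1)) :
    ((P.L ^ i : ℕ)) • combMean (bondAvgIter i Y) y
      = ((P.L ^ i : ℕ)) • (((Fintype.card (Idx P) : ℂ))⁻¹ •
          ∑ idx : Idx P, ((((P.L : ℝ) ^ (P.d + 1)) ^ i)⁻¹) •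
            walkSum (fun b : PBond P i => ∑ x ∈ iterBlock i b.src, segSum Y x b.dir (P.L ^ i)) (walk (emb y) (stairWord idx.2.1 (off idx.1)))) := by
  rw [combMean_def]
  congr 2
  exact Finset.sum_congr rfl fun idx _ => walkSum_bondAvgIter_eq hi Y _

/-- `x + e_κ` is the first site of the straight contour, so the contour from `x + e_κ` is the tail of the contour from `x`. [cite: Balaban1984PropagatorsI, (1.7) p.18] -/
theorem runSite_shift_eq (x : Site P j) (κ : Fin P.d) (t : ℕ) : runSite (x.shift κ) κ t = runSite x κ (t + 1) := by
  rw [show x.shift κ = runSite x κ 1 by rw [runSite_succ, runSite_zero], B5Eq118OneStroke.runSite_add, add_comm]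

omit [Module ℝ V] in
/-- ★ **A STRAIGHT TUBE IS A WALK SUM**: `segSum Y x κ N = walkSum Y (walk x (replicate N (κ, true)))` — so every tube in §§2–5 is itself a level-0 `walkSum X (walk start word)` with an explicit
straight word, as F-c-2's SLIDE∕WORDLOOP steps require. [cite: Balaban1984PropagatorsI, (1.8) p.19] -/
theorem segSum_eq_walkSum_walk_replicate (Y : PBond P j → V) (κ : Fin P.d) : ∀ (N : ℕ) (x : Site P j),
    segSum Y x κ N = walkSum Y (walk x (List.replicate N (κ, true)))
  | 0, x => by simp [segSum, walk, walkSum]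
  | N + 1, x => by
    rw [List.replicate_succ]
    simp only [walk, walkSum_cons, if_true]
    rw [← segSum_eq_walkSum_walk_replicate Y κ N (x.shift κ)]
    -- `segSum Y x κ (N+1) = Y⟨x,κ⟩ + segSum Y (x.shift κ) κ N`
    unfold segSum
    rw [Finset.sum_range_succ', add_comm]
    congr 1
    · simp [runBond]
    · exact Finset.sum_congr rfl fun t _ => by rw [runBond, runBond, runSite_shift_eq]

end Torus

/-! ## §6 At the T³ member: the level-`j` summand of `r₁ X y` issued from the centre `x̂_y = ctr(B(ŷ))` -/

section Member

variable (F : T3Family) {n K : ℕ} (h : n ≤ K)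

/-- The base point and the centres: `x₀ + (L^{K−n}•ŷ + w) = x̂_y + w`, `x̂_y = embIter (K−n) (siteShift y)` (✓`embIter_eq_transl`; `x₀ = basePt = embIter (K−n) 0`).
[cite: Balaban1987RG1, (0.1) p.251; Balaban1985Averaging, (85)–(87) p.31] -/
theorem transl_basePt_add (y : Site (F.P n) 0) (w : LSite (F.P K).d) :
    transl (basePt F n K) (((((F.P K).L : ℤ)) ^ (K - n)) • coordT3 F n K h y + w) = transl (embIter (K - n) (siteShift (sites_eq F n K h) y)) w := by
  have hx := embIter_eq_transl (P := F.P K) (k := K - n) (height_le F n K) (siteShift (sites_eq F n K h) y)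
  rw [transl_add]
  exact congrArg (fun s => transl s w) hx.symm

/-- ★★★ (i-r) **THE LEVEL-`j` SUMMAND OF `r₁ X y` AT THE MEMBER, ISSUED FROM THE CENTRE `x̂_y`**: for `j ≤ k = K − n`,
`F̂(L^{k−j}•ŷ)[LʲQ_j(1)X♯] = Σ_{r∈[0,L)³} L^{−3} • asum (w κ ↦ Σ_{u∈[0,Lʲ)³} (Lʲ)^{−3} • segSum X (x̂_y + (Lʲ•w + u)) κ Lʲ) 0 (treeWord r)` — the tree contour `Γ_{0,r}` of the level-`j` unit lattice
read FROM `0`, each of its steps at the level-`j` site `w` carrying the uniform mean over the CORNERED level-`j` box `x̂_y + Lʲw + [0,Lʲ)³ ⊂ T_{j+1} = x̂_y + [0,L^{j+1})³` of the straight torus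
tubes of length `Lʲ` — SPEC-Fc2 v2 S2's `C_r : … → U(T_j) → U(T_{j+1}) → …` with issue point `ctr(ŷ) = x̂_y` DISPLAYED (with ✓`fderiv_frameTw_one_apply`: `r₁ X y = Σ_{j<k}` of these).
[cite: Balaban1985Averaging, (160) p.42, (112) p.34, (127) p.37; Balaban1984PropagatorsI, (1.18) p.20] -/
theorem frameResponse_level_eq_centred (X : PBond (F.P K) 0 → Matrix (Fin 2) (Fin 2) ℂ) (y : Site (F.P n) 0) {i : ℕ} (hi : i ≤ K - n) :
    Fhat (F.P K).L (linQIter (F.P K).L (fun (z : LSite (F.P K).d) (κ : Fin (F.P K).d) => X ⟨transl (basePt F n K) z, κ⟩) i)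
        ((((F.P K).L : ℤ) ^ (K - n - i)) • coordT3 F n K h y)
      = ∑ r : Fin (F.P K).d → Fin (F.P K).L, ((((F.P K).L : ℝ) ^ (F.P K).d)⁻¹) •
          asum (fun (w : LSite (F.P K).d) (κ : Fin (F.P K).d) =>
              ∑ u : Fin (F.P K).d → Fin ((F.P K).L ^ i), (((((F.P K).L ^ i : ℕ) : ℝ) ^ (F.P K).d)⁻¹) •
                segSum X (transl (embIter (K - n) (siteShift (sites_eq F n K h) y)) (((((F.P K).L ^ i : ℕ) : ℤ)) • w + boxVec ((F.P K).L ^ i) u)) κ ((F.P K).L ^ i))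
            0 (treeWord (boxVec (F.P K).L r)) := by
  -- the re-anchoring of the smearing boxes at the centre `x̂_y`
  have key : ∀ (w : LSite (F.P K).d) (u : Fin (F.P K).d → Fin ((F.P K).L ^ i)),
      transl (basePt F n K) (((((F.P K).L ^ i : ℕ) : ℤ)) • (((((F.P K).L : ℤ)) ^ (K - n - i)) • coordT3 F n K h y + w) + boxVec ((F.P K).L ^ i) u)
        = transl (embIter (K - n) (siteShift (sites_eq F n K h) y)) (((((F.P K).L ^ i : ℕ) : ℤ)) • w + boxVec ((F.P K).L ^ i) u) := by
    intro w u
    rw [← transl_basePt_add F h y, smul_add, smul_smul, add_assoc,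
      show ((((F.P K).L ^ i : ℕ) : ℤ)) * (((F.P K).L : ℤ)) ^ (K - n - i) = (((F.P K).L : ℤ)) ^ (K - n) by
        push_cast; rw [← pow_add, Nat.add_sub_cancel' hi]]
  have hfield : (fun (z : LSite (F.P K).d) (κ : Fin (F.P K).d) =>
        (fun (w : LSite (F.P K).d) (κ : Fin (F.P K).d) =>
            ∑ u : Fin (F.P K).d → Fin ((F.P K).L ^ i), (((((F.P K).L ^ i : ℕ) : ℝ) ^ (F.P K).d)⁻¹) •
              segSum X (transl (basePt F n K) (((((F.P K).L ^ i : ℕ) : ℤ)) • w + boxVec ((F.P K).L ^ i) u)) κ ((F.P K).L ^ i))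
          (((((F.P K).L : ℤ) ^ (K - n - i)) • coordT3 F n K h y) + z) κ)
      = fun (w : LSite (F.P K).d) (κ : Fin (F.P K).d) =>
          ∑ u : Fin (F.P K).d → Fin ((F.P K).L ^ i), (((((F.P K).L ^ i : ℕ) : ℝ) ^ (F.P K).d)⁻¹) •
            segSum X (transl (embIter (K - n) (siteShift (sites_eq F n K h) y)) (((((F.P K).L ^ i : ℕ) : ℤ)) • w + boxVec ((F.P K).L ^ i) u)) κ ((F.P K).L ^ i) := by
    funext w κ
    refine Finset.sum_congr rfl fun u _ => ?_
    rw [key w u]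
    rfl
  rw [Fhat_linQIter_pull_eq]
  refine Finset.sum_congr rfl fun r _ => ?_
  rw [asum_rebase_zero, hfield]

/-- ★★ (i-T) **`Lᵏ•Q_kX(ĉ)` AT THE MEMBER AS THE UNIFORM MEAN OVER THE BLOCK `B(ĉ₋)` OF THE STRAIGHT TUBES OF LENGTH `ℓ = Lᵏ`** (the `ℂ`-scalar letter of ✓`QTwS_one_apply`).
[cite: Balaban1984PropagatorsI, (1.18) p.20] -/
theorem csmul_bondAvgIter_eq_blockMean_segSum (X : PBond (F.P K) 0 → Matrix (Fin 2) (Fin 2) ℂ) (b : PBond (F.P K) (K - n)) :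
    ((((F.P K).L : ℕ) : ℂ) ^ (K - n)) • bondAvgIter (K - n) X b
      = (((((F.P K).L : ℝ) ^ (K - n)) ^ (F.P K).d)⁻¹) • ∑ x ∈ iterBlock (K - n) b.src, segSum X x b.dir ((F.P K).L ^ (K - n)) := by
  rw [← smul_bondAvgIter_eq_cellMean_segSum (height_le F n K) X b, ← Complex.coe_smul]
  push_cast
  rfl

end Member

end Summit.QuantumFields.YangMills.Theorems.Prop7DefectChainForms

end
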